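import Mathlib
import HarnessLib
import Summits.NavierStokesRegularity.NavierStokesRegularity.Theorems.TaylorModelRungThreeCertificateFormatVInterp

/-!
# Crux K1b-DR (stmt-NavierStokesRegularity-23954), line `taylor-model` — v3 certificate interpretation, GENERALISED inputs:
# the stage context and the semantic records parameterised by a per-stage core kit `kitOf` and a per-stage EMITTED tube
# inflation vector `wT` (successor engine-1 g67; cert-1 g2 10:36Z «per-coordinate inflation infl_c», tm-g4's (R1))

`…FormatVInterp` fixed the outer-hull inflation to the scalar recipe `tubeW = (Λdes·κ·ω)↑` and one global `CoreKit`. The float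
twin (cert-1 g2, kit j306048) shows the scalar inflation over-inflates the top shell (δ_j ∝ M_Ka³), so the inflation must be an
EMITTED per-coordinate vector certified afterwards by the tube-growth products of the read-outs checker («κ_j·LamRow_c ≤ infl_c»).
This file is the same interpretation with those two inputs as PARAMETERS (chosen data — soundness is unaffected; only the hull
nesting needs `wT ≥ 0`, a tested Boolean): `ctxOfW`, `nodeVW`/`subVW`/`coreVW`, `radLW`, `toCertDataVW`, `toBoxesW`,
`toRadiiW`; the scalar family of `…FormatVInterp` is the special case `kitOf := fun _ => kit`, `wT := TV.tubeW`
(`ctxOf_eq_ctxOfW`). The soundness files (`…FormatVRadiiSound`, …) are stated for THIS family.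

MODEL-lattice rung TL-M3 only; nothing here is a statement about the Navier–Stokes equations, and nothing is asserted.
-/

-- the sub-problem namespace repeats the summit name by design (D-0017)
set_option linter.dupNamespace false

namespace Summit.NavierStokesRegularity.NavierStokesRegularity.Theorems.TaylorModelCert

open scoped BigOperators
open Literature.Analysis.FluidPDE.TaoCascade Literature.Analysis.FluidPDE.TaoCascade.TaylorChain
open Summit.NavierStokesRegularity.NavierStokesRegularity.Theorems.TaylorModelReadout
open Summit.NavierStokesRegularity.NavierStokesRegularity.Theorems.TaylorModelV

namespace CertTablesV

variable (TV : CertTablesV) (kitOf : ℕ → CoreKit) (wT : ℕ → Array Dyad)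

/-- The core function of stage `j` (kit `kitOf j`). [folklore] -/
def coreFW (j : ℕ) : Array IntervalD → Dyad → Dyad → CoreOut := fun H2 h L1 =>
  TV.base.coreStep
    { coefB := (kitOf j).coefB, mt := (kitOf j).mt, prec := TV.prec, p := TV.base.pdeg, pV := TV.pdegV, infl := (kitOf j).infl,
      H2 := H2, h := h, κωB := TV.κωB j, ωB := TV.ωB j, ωinvB := TV.ωinvB j, L1 := L1 }

/-- **The loop context of stage `j`** (kit `kitOf j`, inflation `wT j`). [folklore] -/
def ctxOfW (j : ℕ) : StageCtx :=
  { n := TV.base.n, prec := TV.prec, precV := (kitOf j).precV, precB := TV.precB, p := TV.base.pdeg,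
    rB := (TV.stageV j).rB, wT := wT j, L1₀ := (kitOf j).L1₀, core := TV.coreFW kitOf j,
    QBA := TV.base.qBboxMA (kitOf j).coefB TV.prec (kitOf j).mt, x := TV.xD j, h := TV.hD j, E := TV.nodeE j,
    N0 := TV.entryNode j }

/-- Node state `(j, s)`. [folklore] -/
def nodeVW (j s : ℕ) : NodeSt := (TV.ctxOfW kitOf wT j).nodeAt s

/-- Sub-step output `(j, s)`. [folklore] -/
def subVW (j s : ℕ) : StageCtx.SubOut := (TV.ctxOfW kitOf wT j).subStep s (TV.nodeVW kitOf wT j s)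

/-- Core output `(j, s)`. [folklore] -/
def coreVW (j s : ℕ) : CoreOut := (TV.subVW kitOf wT j s).core

/-- Hull radii by level: `0 ↦ |B|·rp`, `1 ↦ |Vc|·rB + e + |B|·rp`, `2 ↦ level 1 + wT`. [folklore] -/
def radLW (j : ℕ) (l : Fin 3) (N : NodeSt) : Array Dyad :=
  match l with
  | ⟨0, _⟩ => absMulVecUp TV.base.n TV.prec (absD TV.base.n N.B) N.rp
  | ⟨1, _⟩ => (TV.ctxOfW kitOf wT j).hullRad N
  | ⟨_ + 2, _⟩ => addVecUp TV.base.n TV.prec ((TV.ctxOfW kitOf wT j).hullRad N) (wT j)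

/-! ### The semantic records -/

/-- **The `CertData` record presented by a v3 certificate** (see the module docstring). [folklore] -/
noncomputable def toCertDataVW (sc : ScalarsV) : CertData :=
  { TV.base.toCertData QS2.toRealHom with
    h := fun j s => TV.hR j s
    Tn := fun j s => TV.TnR j s
    x := fun j s => TV.xR j s
    P := fun j s m => taylorJet (TV.base.toCertData QS2.toRealHom).Qb (TV.xR j s) m
    Wv := fun j s m v =>
      if m ≤ TV.pdegV then varJet (TV.base.toCertData QS2.toRealHom).Qb (TV.xR j s)
        (trunc (TV.base.toCertData QS2.toRealHom) v) m else 0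
    Cm := fun j s => TV.base.linF (dre (TV.nodeVW kitOf wT j s).B)
    Ci := fun j s => TV.base.linF (invMat TV.base.n (TV.nodeVW kitOf wT j s).B)
    rP := fun j s => TV.base.vecF (vre (TV.nodeVW kitOf wT j s).rp)
    L1 := fun j s => (TV.coreVW kitOf wT j s).L1.toReal
    mC := sc.mC, mT := sc.mT, EI := sc.EI, E := sc.E, EO := sc.EO, ρ := sc.ρ, ρO := sc.ρO, NVh := sc.NVh, NV := sc.NV
    dP := sc.dP, SpI := sc.SpI, Sp := sc.Sp, SpO := sc.SpO, NCi := sc.NCi, κB := sc.κB }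

/-- **The `StepBoxes` record presented by a v3 certificate.** [folklore] -/
noncomputable def toBoxesW : StepBoxes where
  pdegV := TV.pdegV
  rPl := fun _ j s => TV.base.vecF (vre (TV.nodeVW kitOf wT j s).rp)
  hlo := fun l j s => TV.base.vecF (loOf (TV.xD j s) (TV.radLW kitOf wT j l (TV.nodeVW kitOf wT j s)))
  hhi := fun l j s => TV.base.vecF (hiOf (TV.xD j s) (TV.radLW kitOf wT j l (TV.nodeVW kitOf wT j s)))
  lo := fun j s => TV.base.vecF (vre (TV.coreVW kitOf wT j s).lo)
  hi := fun j s => TV.base.vecF (vre (TV.coreVW kitOf wT j s).hi)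
  loK := fun j s => TV.base.vecF (vre (TV.coreVW kitOf wT j s).loK)
  hiK := fun j s => TV.base.vecF (vre (TV.coreVW kitOf wT j s).hiK)
  loV := fun j s => TV.base.vecF (vre (TV.coreVW kitOf wT j s).loV)
  hiV := fun j s => TV.base.vecF (vre (TV.coreVW kitOf wT j s).hiV)
  J := fun j s => TV.base.vecF (vre (TV.coreVW kitOf wT j s).J)
  JU := fun j s => TV.base.vecF (vre (TV.coreVW kitOf wT j s).JU)
  Mlo := fun j s => TV.base.kerLo (TV.coreVW kitOf wT j s).M
  Mhi := fun j s => TV.base.kerHi (TV.coreVW kitOf wT j s).M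

/-- **The `RadiiData` record presented by a v3 certificate.** [folklore] -/
noncomputable def toRadiiW : RadiiData where
  rB := fun j => TV.base.vecF (vre (TV.stageV j).rB)
  Dsc := fun j => TV.base.linF (dre (diagD TV.base.n (TV.stageV j).D))
  Vc := fun j s => TV.base.linF (dre (TV.nodeVW kitOf wT j s).Vc)
  e := fun j s => TV.base.vecF (vre (TV.nodeVW kitOf wT j s).e)
  ν := fun j s => TV.base.vecF (vre ((TV.ctxOfW kitOf wT j).nuOf (TV.coreVW kitOf wT j s) s))
  Zlo := fun j s => TV.base.kerLo (TV.nodeVW kitOf wT j s).Z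
  Zhi := fun j s => TV.base.kerHi (TV.nodeVW kitOf wT j s).Z

/-- The scalar-inflation context of `…FormatVInterp` is the special case `kitOf := fun _ => kit`, `wT := tubeW`. [folklore] -/
theorem ctxOf_eq_ctxOfW (kit : CoreKit) (j : ℕ) : TV.ctxOf kit j = TV.ctxOfW (fun _ => kit) TV.tubeW j := rfl

end CertTablesV

end Summit.NavierStokesRegularity.NavierStokesRegularity.Theorems.TaylorModelCert
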